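import Summits.QuantumFields.YangMills.Theorems.ColdStartUniversalityLatticeLangevinConjugationIdentity
import HarnessLib

/-!
# Route `ColdStartUniversality` (fixed-cut-off SZZ dynamics; conjugation calculus, file 7):
# THE CONJUGATED PRODUCT IS A `C¹` PATH — the random ODE in derivative form

Helper file (seat `ym-line-csu-p1`, g23).  The pathwise conjugation identity (`reIm_conjProduct_pair_eq_add_integral`,
integral form) is turned into its DIFFERENTIAL form: almost surely, the real coordinates
`u ↦ Re/Im((ρU²_e(u))ᴴ ρU¹_e(u))_{ij}` of the conjugated product of two SZZ solutions driven by the same noise are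
differentiable at every `t > 0` (right-differentiable at every `t ≥ 0`), with derivative
`Re/Im((ρU²_e(t))ᴴ (D₁(U¹(t)) − D₂(U²(t))) ρU¹_e(t))_{ij}` — `hasDerivWithinAt_conjProduct_pair`, `hasDerivAt_conjProduct_pair`.
With `β₂ = 0` (`U² = B` the free left-invariant Brownian motion) this is the DOSS–SUSSMANN RANDOM ODE
`d/dt (BᴴU) = Bᴴ D_β(U) U` path by path (`hasDerivAt_dossSussmann`): the door to treating `x ↦ U^x_t(ω)` by ODE flow
theory (smooth dependence on initial data), hence to `C^k`-smoothing of the SZZ semigroup.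
THEOREMS ONLY, no sorry.  HONEST FRAMING: fixed-cut-off calculus; nothing K-uniform; no crux, rung or summit statement
is proved; the Yang–Mills mass gap is NOT proved.
-/

set_option autoImplicit false

noncomputable section

namespace Summit.QuantumFields.YangMills.Theorems.ColdStartUniversality

open MeasureTheory ProbabilityTheory Finset Filter
open scoped NNReal Matrix ComplexConjugate Topology
open Literature.Probability.Process Literature.MathematicalPhysics.QuantumFieldTheory
open Literature.MathematicalPhysics.QuantumLattice (fundamentalRep fundamentalLatticeRep continuous_fundamentalRep
  fundamentalRep_mem_unitaryGroup)

/-- ★ **The conjugated product is `C¹`: derivative form of the conjugation identity.**  For two regular SZZ solution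
families `U s` (couplings `β s`) driven by the same flat noise, starts `x s`, a link `e`, entry `(i,j)`, `c`: almost
surely, for every real `t ≥ 0` the coordinate `u ↦ Re/Im((ρU²_e(u⁺))ᴴ ρU¹_e(u⁺))_{ij}` has, within `[0,∞)`, the
derivative `Re/Im((ρU²_e(t))ᴴ (D_{β true}(U¹(t)) − D_{β false}(U²(t))) ρU¹_e(t))_{ij}` at `t`
(`u⁺ = Real.toNNReal u`). [folklore] -/
theorem hasDerivWithinAt_conjProduct_pair (L : ℕ) [NeZero L] (β : Bool → ℝ) {Ω : Type} [MeasurableSpace Ω]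
    {P : Measure Ω} [IsProbabilityMeasure P] {W : ℝ≥0 → Ω → (Edge 3 L × NoiseIdx 2 → ℝ)} (hW : IsFlatBrownian W P)
    (U : Bool → GaugeConfig 3 L (Matrix.specialUnitaryGroup (Fin 2) ℂ) → ℝ≥0 → Ω →
      GaugeConfig 3 L (Matrix.specialUnitaryGroup (Fin 2) ℂ))
    (hU : ∀ s x, (∀ ω, U s x 0 ω = x) ∧
      (latticeLangevinDynamics (fundamentalLatticeRep 2) (β s)).IsSolution (fundamentalRep (Fin 2))
        hW.natFiltration P W (U s x))
    (hUm : ∀ (s : Bool) (i : ℝ≥0), Measurable[@Prod.instMeasurableSpace (Set.Iic i)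
        (GaugeConfig 3 L (Matrix.specialUnitaryGroup (Fin 2) ℂ) × Ω) inferInstance
        (@Prod.instMeasurableSpace (GaugeConfig 3 L (Matrix.specialUnitaryGroup (Fin 2) ℂ)) Ω inferInstance
          (hW.natFiltration i))]
      (fun q : Set.Iic i × (GaugeConfig 3 L (Matrix.specialUnitaryGroup (Fin 2) ℂ) × Ω) => U s q.2.1 q.1 q.2.2))
    (x : Bool → GaugeConfig 3 L (Matrix.specialUnitaryGroup (Fin 2) ℂ)) (e : Edge 3 L)
    (i j : Fin (fundamentalLatticeRep 2).N) (c : Bool) :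
    ∀ᵐ ω ∂P, ∀ t : ℝ, 0 ≤ t →
      HasDerivWithinAt
        (fun u : ℝ => (fun z : ℂ => if c then z.im else z.re)
          ((((fundamentalLatticeRep 2).ρ (U false (x false) u.toNNReal ω e))ᴴ *
            (fundamentalLatticeRep 2).ρ (U true (x true) u.toNNReal ω e)) i j))
        ((fun z : ℂ => if c then z.im else z.re)
          ((((fundamentalLatticeRep 2).ρ (U false (x false) t.toNNReal ω e))ᴴ *
            ((fundamentalLatticeRep 2).driftLie (β true)
                (matrixConfig (fundamentalLatticeRep 2).ρ (U true (x true) t.toNNReal ω)) e -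
              (fundamentalLatticeRep 2).driftLie (β false)
                (matrixConfig (fundamentalLatticeRep 2).ρ (U false (x false) t.toNNReal ω)) e) *
            (fundamentalLatticeRep 2).ρ (U true (x true) t.toNNReal ω e)) i j))
        (Set.Ici 0) t := by
  -- the integrand, as a function of real time
  set a : Ω → ℝ → ℝ := fun ω r => (fun z : ℂ => if c then z.im else z.re)
    (((((fundamentalLatticeRep 2).ρ (U false (x false) r.toNNReal ω e))ᴴ *
      ((fundamentalLatticeRep 2).driftLie (β true) (matrixConfig (fundamentalLatticeRep 2).ρ (U true (x true) r.toNNReal ω)) e -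
        (fundamentalLatticeRep 2).driftLie (β false) (matrixConfig (fundamentalLatticeRep 2).ρ (U false (x false) r.toNNReal ω)) e) *
      (fundamentalLatticeRep 2).ρ (U true (x true) r.toNNReal ω e)) i j)) with ha
  have hreIm_cont : Continuous (fun z : ℂ => if c then z.im else z.re) := by
    cases c
    · exact Complex.continuous_re
    · exact Complex.continuous_im
  have hid := reIm_conjProduct_pair_eq_add_integral L β hW U hU hUm x e i j c
  filter_upwards [hid, (hU false (x false)).2.continuous, (hU true (x true)).2.continuous] with ω hω hc2 hc1 t ht
  -- continuity of the integrand along the path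
  have hQc : ∀ (s : Bool), Continuous (fun r : ℝ≥0 => U s (x s) r ω) →
      Continuous fun r : ℝ => (fundamentalLatticeRep 2).ρ (U s (x s) r.toNNReal ω e) := fun s hc =>
    (fundamentalLatticeRep 2).continuous.comp ((continuous_apply e).comp (hc.comp continuous_real_toNNReal))
  have hac : Continuous (a ω) := by
    have hD : Continuous fun r : ℝ => (fundamentalLatticeRep 2).driftLie (β true) (matrixConfig (fundamentalLatticeRep 2).ρ (U true (x true) r.toNNReal ω)) e -
        (fundamentalLatticeRep 2).driftLie (β false) (matrixConfig (fundamentalLatticeRep 2).ρ (U false (x false) r.toNNReal ω)) e :=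
      ((continuous_driftLie_matrixConfig (β true) e).comp (hc1.comp continuous_real_toNNReal)).sub
        ((continuous_driftLie_matrixConfig (β false) e).comp (hc2.comp continuous_real_toNNReal))
    exact hreIm_cont.comp ((continuous_apply j).comp ((continuous_apply i).comp
      (((hQc false hc2).matrix_conjTranspose.matrix_mul hD).matrix_mul (hQc true hc1))))
  -- the primitive `g u = v₀ + ∫₀ᵘ a` has derivative `a t` at `t`
  set v0 : ℝ := (fun z : ℂ => if c then z.im else z.re) (((((fundamentalLatticeRep 2).ρ (x false e)))ᴴ * ((fundamentalLatticeRep 2).ρ (x true e))) i j) with hv0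
  have hg : HasDerivAt (fun u : ℝ => v0 + ∫ r in (0 : ℝ)..u, a ω r) (a ω t) t :=
    ((hac.integral_hasStrictDerivAt 0 t).hasDerivAt).const_add v0
  -- on `[0, ∞)` the coordinate of the conjugated product IS this primitive
  have heq : ∀ u ∈ Set.Ici (0 : ℝ), (fun z : ℂ => if c then z.im else z.re)
      ((((fundamentalLatticeRep 2).ρ (U false (x false) u.toNNReal ω e))ᴴ * ((fundamentalLatticeRep 2).ρ (U true (x true) u.toNNReal ω e))) i j) =
      v0 + ∫ r in (0 : ℝ)..u, a ω r := by
    intro u hu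
    have h := hω u.toNNReal
    rw [Real.coe_toNNReal _ hu] at h
    rw [intervalIntegral.integral_of_le hu]
    exact h
  exact (hg.hasDerivWithinAt (s := Set.Ici 0)).congr heq (heq t ht)

/-- ★ **Two-sided derivative at positive times.**  Same setting: almost surely, for every `t > 0` the coordinate of the
conjugated product is differentiable at `t` with the same derivative. [folklore] -/
theorem hasDerivAt_conjProduct_pair (L : ℕ) [NeZero L] (β : Bool → ℝ) {Ω : Type} [MeasurableSpace Ω]
    {P : Measure Ω} [IsProbabilityMeasure P] {W : ℝ≥0 → Ω → (Edge 3 L × NoiseIdx 2 → ℝ)} (hW : IsFlatBrownian W P)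
    (U : Bool → GaugeConfig 3 L (Matrix.specialUnitaryGroup (Fin 2) ℂ) → ℝ≥0 → Ω →
      GaugeConfig 3 L (Matrix.specialUnitaryGroup (Fin 2) ℂ))
    (hU : ∀ s x, (∀ ω, U s x 0 ω = x) ∧
      (latticeLangevinDynamics (fundamentalLatticeRep 2) (β s)).IsSolution (fundamentalRep (Fin 2))
        hW.natFiltration P W (U s x))
    (hUm : ∀ (s : Bool) (i : ℝ≥0), Measurable[@Prod.instMeasurableSpace (Set.Iic i)
        (GaugeConfig 3 L (Matrix.specialUnitaryGroup (Fin 2) ℂ) × Ω) inferInstance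
        (@Prod.instMeasurableSpace (GaugeConfig 3 L (Matrix.specialUnitaryGroup (Fin 2) ℂ)) Ω inferInstance
          (hW.natFiltration i))]
      (fun q : Set.Iic i × (GaugeConfig 3 L (Matrix.specialUnitaryGroup (Fin 2) ℂ) × Ω) => U s q.2.1 q.1 q.2.2))
    (x : Bool → GaugeConfig 3 L (Matrix.specialUnitaryGroup (Fin 2) ℂ)) (e : Edge 3 L)
    (i j : Fin (fundamentalLatticeRep 2).N) (c : Bool) :
    ∀ᵐ ω ∂P, ∀ t : ℝ, 0 < t →
      HasDerivAt
        (fun u : ℝ => (fun z : ℂ => if c then z.im else z.re)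
          ((((fundamentalLatticeRep 2).ρ (U false (x false) u.toNNReal ω e))ᴴ *
            (fundamentalLatticeRep 2).ρ (U true (x true) u.toNNReal ω e)) i j))
        ((fun z : ℂ => if c then z.im else z.re)
          ((((fundamentalLatticeRep 2).ρ (U false (x false) t.toNNReal ω e))ᴴ *
            ((fundamentalLatticeRep 2).driftLie (β true)
                (matrixConfig (fundamentalLatticeRep 2).ρ (U true (x true) t.toNNReal ω)) e -
              (fundamentalLatticeRep 2).driftLie (β false)
                (matrixConfig (fundamentalLatticeRep 2).ρ (U false (x false) t.toNNReal ω)) e) *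
            (fundamentalLatticeRep 2).ρ (U true (x true) t.toNNReal ω e)) i j)) t := by
  filter_upwards [hasDerivWithinAt_conjProduct_pair L β hW U hU hUm x e i j c] with ω hω t ht
  exact (hω t ht.le).hasDerivAt (Ici_mem_nhds ht)

/-- ★★ **The Doss–Sussmann random ODE, path by path.**  `B` a regular solution family of the FREE dynamics (`β = 0`),
`U` one at coupling `β`, same flat noise, starts `b, x`: almost surely, for every `t > 0`,
`d/dt Re/Im((ρB_e(t))ᴴ ρU_e(t))_{ij} = Re/Im((ρB_e(t))ᴴ D_β(U(t))_e ρU_e(t))_{ij}` — i.e. `V = BᴴU` solves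
`V̇_e = (ρB_e)ᴴ D_β(BV)_e (ρB_e) V_e`. [folklore] -/
theorem hasDerivAt_dossSussmann (L : ℕ) [NeZero L] (β : ℝ) {Ω : Type} [MeasurableSpace Ω]
    {P : Measure Ω} [IsProbabilityMeasure P] {W : ℝ≥0 → Ω → (Edge 3 L × NoiseIdx 2 → ℝ)} (hW : IsFlatBrownian W P)
    (B U : GaugeConfig 3 L (Matrix.specialUnitaryGroup (Fin 2) ℂ) → ℝ≥0 → Ω →
      GaugeConfig 3 L (Matrix.specialUnitaryGroup (Fin 2) ℂ))
    (hB : ∀ x, (∀ ω, B x 0 ω = x) ∧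
      (latticeLangevinDynamics (fundamentalLatticeRep 2) 0).IsSolution (fundamentalRep (Fin 2)) hW.natFiltration P W (B x))
    (hBm : ∀ i : ℝ≥0, Measurable[@Prod.instMeasurableSpace (Set.Iic i)
        (GaugeConfig 3 L (Matrix.specialUnitaryGroup (Fin 2) ℂ) × Ω) inferInstance
        (@Prod.instMeasurableSpace (GaugeConfig 3 L (Matrix.specialUnitaryGroup (Fin 2) ℂ)) Ω inferInstance
          (hW.natFiltration i))]
      (fun q : Set.Iic i × (GaugeConfig 3 L (Matrix.specialUnitaryGroup (Fin 2) ℂ) × Ω) => B q.2.1 q.1 q.2.2))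
    (hU : ∀ x, (∀ ω, U x 0 ω = x) ∧
      (latticeLangevinDynamics (fundamentalLatticeRep 2) β).IsSolution (fundamentalRep (Fin 2)) hW.natFiltration P W (U x))
    (hUm : ∀ i : ℝ≥0, Measurable[@Prod.instMeasurableSpace (Set.Iic i)
        (GaugeConfig 3 L (Matrix.specialUnitaryGroup (Fin 2) ℂ) × Ω) inferInstance
        (@Prod.instMeasurableSpace (GaugeConfig 3 L (Matrix.specialUnitaryGroup (Fin 2) ℂ)) Ω inferInstance
          (hW.natFiltration i))]
      (fun q : Set.Iic i × (GaugeConfig 3 L (Matrix.specialUnitaryGroup (Fin 2) ℂ) × Ω) => U q.2.1 q.1 q.2.2))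
    (b x : GaugeConfig 3 L (Matrix.specialUnitaryGroup (Fin 2) ℂ)) (e : Edge 3 L)
    (i j : Fin (fundamentalLatticeRep 2).N) (c : Bool) :
    ∀ᵐ ω ∂P, ∀ t : ℝ, 0 < t →
      HasDerivAt
        (fun u : ℝ => (fun z : ℂ => if c then z.im else z.re)
          ((((fundamentalLatticeRep 2).ρ (B b u.toNNReal ω e))ᴴ *
            (fundamentalLatticeRep 2).ρ (U x u.toNNReal ω e)) i j))
        ((fun z : ℂ => if c then z.im else z.re)
          ((((fundamentalLatticeRep 2).ρ (B b t.toNNReal ω e))ᴴ *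
            (fundamentalLatticeRep 2).driftLie β (matrixConfig (fundamentalLatticeRep 2).ρ (U x t.toNNReal ω)) e *
            (fundamentalLatticeRep 2).ρ (U x t.toNNReal ω e)) i j)) t := by
  have h := hasDerivAt_conjProduct_pair L (fun s => cond s β 0) hW (fun s => cond s U B)
    (fun s => by cases s <;> simpa using (by first | exact hB | exact hU))
    (fun s => by cases s <;> simpa using (by first | exact hBm | exact hUm)) (fun s => cond s x b) e i j c
  filter_upwards [h] with ω hω t ht
  have h1 := hω t ht
  simp only [cond_true, cond_false, driftLie_zero, sub_zero] at h1
  exact h1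

end Summit.QuantumFields.YangMills.Theorems.ColdStartUniversality

end
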